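import Summits.HodgeConjecture.HodgeConjecture.Theorems.CyclicUnitaryPowersCommutatorAscent
import HarnessLib

/-!
# Cayley parameters for the centraliser-isometry group of a PAIR `(S, T)` with `T⁻¹ S T = S⁻¹` (the quaternion deck
# pair) — brick ASC-Q of programme K2Q, part 1 of 2: the Reynolds map `ρ₂`, numerators, generic polynomials

Cell `hodge-nonav`, prover seat `hodge-nonav-20241-p1` (g20); crux `PowersHodgeOfQuaternionCommutators`
(stmt-HodgeConjecture-24191, route `Q8SymplecticPowers`); memo `PROGRAMME-K2Q-20241p1-g20.md` brick ASC-Q. HELPER FILE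
(`--supports stmt-HodgeConjecture-24191 --as helper`). Sorry-free; axioms standard.

Twin of route A's `CyclicUnitaryPowersCayleyParameters` + `…CommutatorIdentity` + `…CommutatorAscent` (prover-Ax ∕ prover-Bx,
crux K2-A; Goodman–Wallach GTM 255 §2.2.3 Exercise 1 «Cayley parameters», Weyl's irrelevance of algebraic inequalities) with the
ONE deck matrix `S` (`S ^ p = 1`) replaced by a PAIR `S, T` of `G`-isometries with `S ^ p = 1`, `T ^ q = 1` and
`T⁻¹ S T = S⁻¹` — the cohomological quaternion pair `τ^*, j^*` (`p = q = 4`, `j⁻¹τj = τ⁻¹`). Data: rational `S, T, G` (`G`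
symmetric nondegenerate, `Sᵀ G S = G = Tᵀ G T`) and a rational coefficient tensor `c` on words `Fin r → Fin N` fixed by the
Kronecker power of every COMMUTATOR of invertible rational matrices commuting with `S` AND `T` and preserving `G`. Conclusion
(`commutator_invariance_ascends₂`): over every field `K` of characteristic zero, `c` is fixed by the Kronecker power of
`g h g⁻¹ h⁻¹` for all `K`-matrices `g, h` commuting with `S, T`, preserving `G`, with `det (1 + g)`, `det (1 + h)` invertible.

The only new algebra is the REYNOLDS MAP: `ρ₂ := cycAvg_T ∘ cycAvg_S ∘ skewPart` (`rho₂`) replaces route A's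
`ρ = cycAvg_S ∘ skewPart`. Since conjugation by `T` swaps `S` and `S⁻¹` (`conj_pow_alt`), averaging over `⟨T⟩` preserves
`S`-commutation (`cycAvg_comm_of_conj`); hence `ρ₂ M` commutes with `S` and `T` and is `G`-skew, and `ρ₂ = 2pq` on the Lie
algebra `{X : XS = SX, XT = TX, XᵀG + GX = 0}` (`rho₂_of_mem`). Everything else — Cayley numerators, the generic commutator
identity over `MvPolynomial`, the Cayley sections of `K`-points — is route A's, reused BY NAME or re-run verbatim with `ρ₂`.

* §1 `rho₂`, `cycAvg_comm_of_conj`, `rho₂_comm_S`, `rho₂_comm_T`, `rho₂_skew`, `rho₂_of_mem`, `rho₂_smul`, `map_rho₂`;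
* §2 `uNum₂`, `uDen₂`, naturality, `uDen₂_zero`; §3 the generic polynomials `innerPoly₂`, `denPoly₂` and their evaluations;
* (part 2, `Q8SymplecticPowersCommutatorAscent`) §4 the field step and the generic identity; §5 `commutator_invariance_ascends₂`.

Honest scope: matrix algebra; nothing here says HC, HC_CM or HC_AV is proved.

References: [GoodmanWallachGTM255] R. Goodman, N. Wallach, *Symmetry, Representations, and Invariants*, Exercises 1.4.5 #5 and
§2.2.3 Exercise 1.
-/

set_option linter.dupNamespace false

noncomputable section

open Matrix MvPolynomial
open scoped BigOperators

namespace Summit.HodgeConjecture.HodgeConjecture.Theorems.Q8SymplecticPowersCayleyParameters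

open Summit.HodgeConjecture.HodgeConjecture.Theorems.CyclicUnitaryPowersCayleyParameters
open Summit.HodgeConjecture.HodgeConjecture.Theorems.CyclicUnitaryPowersCommutatorIdentity
open Summit.HodgeConjecture.HodgeConjecture.Theorems.CyclicUnitaryPowersCommutatorAscent
open Literature.NumberTheory.DiophantineGeometry (tensorPowerMatrix tensorPowerMatrix_apply)

variable {n : Type*} [Fintype n] [DecidableEq n]

/-! ### §1 The Reynolds map `ρ₂` for the pair `(S, T)` -/

section Rho

variable {R : Type*} [CommRing R]

/-- `ρ₂ = cycAvg_T ∘ cycAvg_S ∘ skewPart`. [cite: GoodmanWallachGTM255, §2.2.3 Exercise 1] -/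
def rho₂ (S Si T Ti G Gi : Matrix n n R) (p q : ℕ) (M : Matrix n n R) : Matrix n n R :=
  cycAvg T Ti q (rho S Si G Gi p M)

/-- A matrix commuting with `S` commutes with `S⁻¹`. [folklore] -/
theorem comm_inv_of_comm {S Si M : Matrix n n R} (hSSi : S * Si = 1) (hSiS : Si * S = 1) (h : M * S = S * M) :
    M * Si = Si * M := by
  calc M * Si = Si * S * M * Si := by rw [hSiS, Matrix.one_mul]
    _ = Si * (M * S) * Si := by rw [Matrix.mul_assoc Si S M, ← h]
    _ = Si * M * (S * Si) := by simp only [Matrix.mul_assoc]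
    _ = Si * M := by rw [hSSi, Matrix.mul_one]

/-- Conjugation by powers of `T` alternates `S` and `S⁻¹` when `T⁻¹ S T = S⁻¹`. [folklore] -/
theorem conj_pow_alt {S Si T Ti : Matrix n n R} (hTS : Ti * S * T = Si) (hTSi : Ti * Si * T = S) (i : ℕ) :
    (Ti ^ i * S * T ^ i = S ∧ Ti ^ i * Si * T ^ i = Si) ∨ (Ti ^ i * S * T ^ i = Si ∧ Ti ^ i * Si * T ^ i = S) := by
  induction i with
  | zero => left; simp
  | succ k ih =>
    have step : ∀ X : Matrix n n R, Ti ^ (k + 1) * X * T ^ (k + 1) = Ti * (Ti ^ k * X * T ^ k) * T := fun X => by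
      rw [pow_succ', pow_succ]; simp only [Matrix.mul_assoc]
    rcases ih with ⟨h1, h2⟩ | ⟨h1, h2⟩
    · right; rw [step, step, h1, h2]; exact ⟨hTS, hTSi⟩
    · left; rw [step, step, h1, h2]; exact ⟨hTSi, hTS⟩

/-- Averaging over `⟨T⟩` preserves commutation with `S` when conjugation by `T` swaps `S`, `S⁻¹`.
[cite: GoodmanWallachGTM255, §2.2.3 Exercise 1] -/
theorem cycAvg_comm_of_conj {S Si T Ti : Matrix n n R} {q : ℕ} (hTTi : T * Ti = 1) (hTiT : Ti * T = 1)
    (hTS : Ti * S * T = Si) (hTSi : Ti * Si * T = S) {M : Matrix n n R} (hMS : M * S = S * M)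
    (hMSi : M * Si = Si * M) : cycAvg T Ti q M * S = S * cycAvg T Ti q M := by
  unfold cycAvg
  rw [Finset.sum_mul, Finset.mul_sum]
  refine Finset.sum_congr rfl fun i _ => ?_
  have hc : Commute T Ti := by rw [Commute, SemiconjBy, hTTi, hTiT]
  have hTTi' : T ^ i * Ti ^ i = 1 := by rw [← hc.mul_pow, hTTi, one_pow]
  have hTiT' : Ti ^ i * T ^ i = 1 := by rw [← hc.symm.mul_pow, hTiT, one_pow]
  -- `X := Ti^i S T^i ∈ {S, S⁻¹}` commutes with `M`
  set X := Ti ^ i * S * T ^ i with hX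
  have hXM : M * X = X * M := by
    rcases conj_pow_alt hTS hTSi i with ⟨h1, -⟩ | ⟨h1, -⟩
    · rw [hX, h1]; exact hMS
    · rw [hX, h1]; exact hMSi
  have h1 : S * T ^ i = T ^ i * X := by
    rw [hX, ← Matrix.mul_assoc, ← Matrix.mul_assoc, hTTi', Matrix.one_mul]
  have h2 : X * Ti ^ i = Ti ^ i * S := by
    rw [hX]
    simp only [Matrix.mul_assoc]
    rw [hTTi', Matrix.mul_one]
  calc T ^ i * M * Ti ^ i * S = T ^ i * M * (X * Ti ^ i) := by rw [Matrix.mul_assoc, ← h2]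
    _ = T ^ i * (M * X) * Ti ^ i := by simp only [Matrix.mul_assoc]
    _ = T ^ i * (X * M) * Ti ^ i := by rw [hXM]
    _ = (T ^ i * X) * M * Ti ^ i := by simp only [Matrix.mul_assoc]
    _ = S * (T ^ i * M * Ti ^ i) := by rw [← h1]; simp only [Matrix.mul_assoc]

/-- `ρ₂ M` commutes with `S`. [cite: GoodmanWallachGTM255, §2.2.3 Exercise 1] -/
theorem rho₂_comm_S {S Si T Ti G Gi : Matrix n n R} {p q : ℕ} (hSp : S ^ p = 1) (hSSi : S * Si = 1)
    (hSiS : Si * S = 1) (hTTi : T * Ti = 1) (hTiT : Ti * T = 1) (hTS : Ti * S * T = Si) (hTSi : Ti * Si * T = S)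
    (M : Matrix n n R) : rho₂ S Si T Ti G Gi p q M * S = S * rho₂ S Si T Ti G Gi p q M := by
  unfold rho₂
  have h := rho_comm (G := G) (Gi := Gi) hSp hSSi hSiS M
  exact cycAvg_comm_of_conj hTTi hTiT hTS hTSi h (comm_inv_of_comm hSSi hSiS h)

/-- `ρ₂ M` commutes with `T`. [cite: GoodmanWallachGTM255, §2.2.3 Exercise 1] -/
theorem rho₂_comm_T {S Si T Ti G Gi : Matrix n n R} {p q : ℕ} (hTq : T ^ q = 1) (hTTi : T * Ti = 1)
    (hTiT : Ti * T = 1) (M : Matrix n n R) : rho₂ S Si T Ti G Gi p q M * T = T * rho₂ S Si T Ti G Gi p q M :=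
  cycAvg_comm hTq hTTi hTiT _

/-- `ρ₂ M` is `G`-skew. [cite: GoodmanWallachGTM255, §2.2.3 Exercise 1] -/
theorem rho₂_skew {S Si T Ti G Gi : Matrix n n R} {p q : ℕ} (hSG : Sᵀ * G * S = G) (hSSi : S * Si = 1)
    (hTG : Tᵀ * G * T = G) (hTTi : T * Ti = 1) (hGt : Gᵀ = G) (hGit : Giᵀ = Gi) (hGGi : G * Gi = 1)
    (hGiG : Gi * G = 1) (M : Matrix n n R) :
    (rho₂ S Si T Ti G Gi p q M)ᵀ * G + G * rho₂ S Si T Ti G Gi p q M = 0 :=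
  cycAvg_skew hTG hTTi (rho_skew hSG hSSi hGt hGit hGGi hGiG M)

/-- `ρ₂ = 2pq` on the Lie algebra of the centraliser-isometry group of the pair.
[cite: GoodmanWallachGTM255, §2.2.3 Exercise 1] -/
theorem rho₂_of_mem {S Si T Ti G Gi : Matrix n n R} {p q : ℕ} (hSSi : S * Si = 1) (hSiS : Si * S = 1)
    (hTTi : T * Ti = 1) (hTiT : Ti * T = 1) (hGiG : Gi * G = 1) {Y : Matrix n n R} (hYS : Y * S = S * Y)
    (hYT : Y * T = T * Y) (hY : Yᵀ * G + G * Y = 0) :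
    rho₂ S Si T Ti G Gi p q Y = (2 * p * q : ℕ) • Y := by
  unfold rho₂
  rw [rho_of_mem hSSi hSiS hGiG hYS hY]
  have hcomm : ∀ i : ℕ, T ^ i * Y * Ti ^ i = Y := by
    intro i
    have hc : T ^ i * Y = Y * T ^ i := by
      induction i with
      | zero => simp
      | succ k ih => rw [pow_succ, Matrix.mul_assoc, ← hYT, ← Matrix.mul_assoc, ih, Matrix.mul_assoc]
    have hTTi' : T ^ i * Ti ^ i = 1 := by
      rw [← (show Commute T Ti from by rw [Commute, SemiconjBy, hTTi, hTiT]).mul_pow, hTTi, one_pow]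
    rw [hc, Matrix.mul_assoc, hTTi', Matrix.mul_one]
  unfold cycAvg
  simp_rw [Matrix.mul_smul, Matrix.smul_mul, hcomm]
  rw [Finset.sum_const, Finset.card_range, smul_smul, mul_comm q]

/-- `ρ₂` is linear over scalars. [folklore] -/
theorem rho₂_smul (S Si T Ti G Gi : Matrix n n R) (p q : ℕ) (a : R) (M : Matrix n n R) :
    rho₂ S Si T Ti G Gi p q (a • M) = a • rho₂ S Si T Ti G Gi p q M := by
  unfold rho₂
  rw [rho_smul]
  unfold cycAvg
  rw [Finset.smul_sum]
  refine Finset.sum_congr rfl fun i _ => ?_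
  rw [Matrix.mul_smul, Matrix.smul_mul]

/-- `ρ₂ 0 = 0`. [folklore] -/
theorem rho₂_zero (S Si T Ti G Gi : Matrix n n R) (p q : ℕ) : rho₂ S Si T Ti G Gi p q 0 = 0 := by
  have h := rho₂_smul S Si T Ti G Gi p q 0 0
  rwa [zero_smul, zero_smul] at h

variable {R' : Type*} [CommRing R']

/-- Naturality of `ρ₂`. [folklore] -/
theorem map_rho₂ (f : R →+* R') (S Si T Ti G Gi : Matrix n n R) (p q : ℕ) (M : Matrix n n R) :
    f.mapMatrix (rho₂ S Si T Ti G Gi p q M) =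
      rho₂ (f.mapMatrix S) (f.mapMatrix Si) (f.mapMatrix T) (f.mapMatrix Ti) (f.mapMatrix G) (f.mapMatrix Gi) p q
        (f.mapMatrix M) := by
  unfold rho₂
  rw [map_cycAvg, map_rho]

end Rho

/-! ### §2 Numerator, denominator and their naturality -/

section Universal

variable {R R' : Type*} [CommRing R] [CommRing R']

/-- Numerator of the commutator of the Cayley transforms of `ρ₂ A`, `ρ₂ B`. [cite: GoodmanWallachGTM255, §2.2.3 Exercise 1] -/
def uNum₂ (S Si T Ti G Gi : Matrix n n R) (p q : ℕ) (A B : Matrix n n R) : Matrix n n R :=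
  cayleyNum (rho₂ S Si T Ti G Gi p q A) * cayleyNum (rho₂ S Si T Ti G Gi p q B) *
    cayleyInvNum (rho₂ S Si T Ti G Gi p q A) * cayleyInvNum (rho₂ S Si T Ti G Gi p q B)

/-- Denominator of the same commutator. [cite: GoodmanWallachGTM255, §2.2.3 Exercise 1] -/
def uDen₂ (S Si T Ti G Gi : Matrix n n R) (p q : ℕ) (A B : Matrix n n R) : R :=
  (1 + rho₂ S Si T Ti G Gi p q A).det * (1 + rho₂ S Si T Ti G Gi p q B).det *
    (1 - rho₂ S Si T Ti G Gi p q A).det * (1 - rho₂ S Si T Ti G Gi p q B).det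

/-- Naturality of `uNum₂`. [folklore] -/
theorem map_uNum₂ (f : R →+* R') (S Si T Ti G Gi : Matrix n n R) (p q : ℕ) (A B : Matrix n n R) :
    f.mapMatrix (uNum₂ S Si T Ti G Gi p q A B) =
      uNum₂ (f.mapMatrix S) (f.mapMatrix Si) (f.mapMatrix T) (f.mapMatrix Ti) (f.mapMatrix G) (f.mapMatrix Gi)
        p q (f.mapMatrix A) (f.mapMatrix B) := by
  unfold uNum₂
  rw [map_mul, map_mul, map_mul, map_cayleyNum, map_cayleyNum, map_cayleyInvNum, map_cayleyInvNum, map_rho₂,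
    map_rho₂]

/-- Naturality of `uDen₂`. [folklore] -/
theorem map_uDen₂ (f : R →+* R') (S Si T Ti G Gi : Matrix n n R) (p q : ℕ) (A B : Matrix n n R) :
    f (uDen₂ S Si T Ti G Gi p q A B) =
      uDen₂ (f.mapMatrix S) (f.mapMatrix Si) (f.mapMatrix T) (f.mapMatrix Ti) (f.mapMatrix G) (f.mapMatrix Gi)
        p q (f.mapMatrix A) (f.mapMatrix B) := by
  unfold uDen₂
  rw [map_mul, map_mul, map_mul, RingHom.map_det, RingHom.map_det, RingHom.map_det, RingHom.map_det, map_add,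
    map_add, map_sub, map_sub, map_one, map_rho₂, map_rho₂]

/-- At `A = B = 0` the denominator is `1`. [folklore] -/
theorem uDen₂_zero (S Si T Ti G Gi : Matrix n n R) (p q : ℕ) : uDen₂ S Si T Ti G Gi p q 0 0 = 1 := by
  unfold uDen₂
  rw [rho₂_zero, add_zero, sub_zero, det_one]; ring

end Universal

/-! ### §3 The generic polynomials -/

section Generic

variable {N : ℕ}

/-- The inner polynomial for the pair `(S, T)`. [cite: GoodmanWallachGTM255, §2.2.3 Exercise 1] -/
def innerPoly₂ (S Si T Ti G Gi : Matrix (Fin N) (Fin N) ℚ) (p q r : ℕ) (c : (Fin r → Fin N) → ℚ)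
    (w' : Fin r → Fin N) : MvPolynomial (Vars N) ℚ :=
  (tensorPowerMatrix (MvPolynomial (Vars N) ℚ) N r
      (uNum₂ (S.map (algebraMap ℚ _)) (Si.map (algebraMap ℚ _)) (T.map (algebraMap ℚ _)) (Ti.map (algebraMap ℚ _))
        (G.map (algebraMap ℚ _)) (Gi.map (algebraMap ℚ _)) p q genA genB) *ᵥ (fun w => algebraMap ℚ _ (c w))) w' -
    uDen₂ (S.map (algebraMap ℚ _)) (Si.map (algebraMap ℚ _)) (T.map (algebraMap ℚ _)) (Ti.map (algebraMap ℚ _))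
        (G.map (algebraMap ℚ _)) (Gi.map (algebraMap ℚ _)) p q genA genB ^ r * algebraMap ℚ _ (c w')

/-- The denominator polynomial for the pair `(S, T)`. [cite: GoodmanWallachGTM255, §2.2.3 Exercise 1] -/
def denPoly₂ (S Si T Ti G Gi : Matrix (Fin N) (Fin N) ℚ) (p q : ℕ) : MvPolynomial (Vars N) ℚ :=
  uDen₂ (S.map (algebraMap ℚ _)) (Si.map (algebraMap ℚ _)) (T.map (algebraMap ℚ _)) (Ti.map (algebraMap ℚ _))
    (G.map (algebraMap ℚ _)) (Gi.map (algebraMap ℚ _)) p q genA genB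

/-- Evaluation of the inner polynomial at a pair of matrices over a `ℚ`-algebra. [cite: GoodmanWallachGTM255, §2.2.3 Exercise 1] -/
theorem aeval_innerPoly₂ {K : Type*} [CommRing K] [Algebra ℚ K] (S Si T Ti G Gi : Matrix (Fin N) (Fin N) ℚ)
    (p q r : ℕ) (c : (Fin r → Fin N) → ℚ) (w' : Fin r → Fin N) (A B : Matrix (Fin N) (Fin N) K) :
    MvPolynomial.aeval (pt A B) (innerPoly₂ S Si T Ti G Gi p q r c w') =
      (tensorPowerMatrix K N r (uNum₂ (S.map (algebraMap ℚ K)) (Si.map (algebraMap ℚ K)) (T.map (algebraMap ℚ K))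
          (Ti.map (algebraMap ℚ K)) (G.map (algebraMap ℚ K)) (Gi.map (algebraMap ℚ K)) p q A B) *ᵥ
          (fun w => algebraMap ℚ K (c w))) w' -
        uDen₂ (S.map (algebraMap ℚ K)) (Si.map (algebraMap ℚ K)) (T.map (algebraMap ℚ K)) (Ti.map (algebraMap ℚ K))
          (G.map (algebraMap ℚ K)) (Gi.map (algebraMap ℚ K)) p q A B ^ r * algebraMap ℚ K (c w') := by
  set f : MvPolynomial (Vars N) ℚ →ₐ[ℚ] K := MvPolynomial.aeval (pt A B) with hf
  set UP := uNum₂ (S.map (algebraMap ℚ (MvPolynomial (Vars N) ℚ))) (Si.map (algebraMap ℚ _))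
    (T.map (algebraMap ℚ _)) (Ti.map (algebraMap ℚ _)) (G.map (algebraMap ℚ _)) (Gi.map (algebraMap ℚ _)) p q
    genA genB with hUP
  set UK := uNum₂ (S.map (algebraMap ℚ K)) (Si.map (algebraMap ℚ K)) (T.map (algebraMap ℚ K))
    (Ti.map (algebraMap ℚ K)) (G.map (algebraMap ℚ K)) (Gi.map (algebraMap ℚ K)) p q A B with hUK
  have hU : (f : MvPolynomial (Vars N) ℚ →+* K).mapMatrix UP = UK := by
    rw [hUP, map_uNum₂, mapMatrix_map_algebraMap f S, mapMatrix_map_algebraMap f Si, mapMatrix_map_algebraMap f T,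
      mapMatrix_map_algebraMap f Ti, mapMatrix_map_algebraMap f G, mapMatrix_map_algebraMap f Gi, mapMatrix_aeval_genA,
      mapMatrix_aeval_genB]
  have hD : f (uDen₂ (S.map (algebraMap ℚ _)) (Si.map (algebraMap ℚ _)) (T.map (algebraMap ℚ _))
      (Ti.map (algebraMap ℚ _)) (G.map (algebraMap ℚ _)) (Gi.map (algebraMap ℚ _)) p q genA genB) =
      uDen₂ (S.map (algebraMap ℚ K)) (Si.map (algebraMap ℚ K)) (T.map (algebraMap ℚ K)) (Ti.map (algebraMap ℚ K))
        (G.map (algebraMap ℚ K)) (Gi.map (algebraMap ℚ K)) p q A B := by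
    have := map_uDen₂ (f : MvPolynomial (Vars N) ℚ →+* K) (S.map (algebraMap ℚ _)) (Si.map (algebraMap ℚ _))
      (T.map (algebraMap ℚ _)) (Ti.map (algebraMap ℚ _)) (G.map (algebraMap ℚ _)) (Gi.map (algebraMap ℚ _)) p q
      genA genB
    rw [mapMatrix_map_algebraMap, mapMatrix_map_algebraMap, mapMatrix_map_algebraMap, mapMatrix_map_algebraMap,
      mapMatrix_map_algebraMap, mapMatrix_map_algebraMap, mapMatrix_aeval_genA, mapMatrix_aeval_genB,
      RingHom.coe_coe] at this
    exact this
  unfold innerPoly₂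
  rw [← hUP, map_sub, map_mul, map_pow, AlgHom.commutes, hD]
  congr 1
  simp only [Matrix.mulVec, dotProduct, map_sum, map_mul, AlgHom.commutes]
  refine Finset.sum_congr rfl fun w _ => ?_
  congr 1
  rw [tensorPowerMatrix_apply, tensorPowerMatrix_apply, map_prod]
  refine Finset.prod_congr rfl fun k _ => ?_
  have := congrFun (congrFun hU (w' k)) (w k)
  rw [RingHom.mapMatrix_apply, Matrix.map_apply, RingHom.coe_coe] at this
  exact this

/-- Evaluation of the denominator polynomial. [cite: GoodmanWallachGTM255, §2.2.3 Exercise 1] -/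
theorem aeval_denPoly₂ {K : Type*} [CommRing K] [Algebra ℚ K] (S Si T Ti G Gi : Matrix (Fin N) (Fin N) ℚ)
    (p q : ℕ) (A B : Matrix (Fin N) (Fin N) K) :
    MvPolynomial.aeval (pt A B) (denPoly₂ S Si T Ti G Gi p q) =
      uDen₂ (S.map (algebraMap ℚ K)) (Si.map (algebraMap ℚ K)) (T.map (algebraMap ℚ K)) (Ti.map (algebraMap ℚ K))
        (G.map (algebraMap ℚ K)) (Gi.map (algebraMap ℚ K)) p q A B := by
  set f : MvPolynomial (Vars N) ℚ →ₐ[ℚ] K := MvPolynomial.aeval (pt A B) with hf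
  have := map_uDen₂ (f : MvPolynomial (Vars N) ℚ →+* K) (S.map (algebraMap ℚ _)) (Si.map (algebraMap ℚ _))
    (T.map (algebraMap ℚ _)) (Ti.map (algebraMap ℚ _)) (G.map (algebraMap ℚ _)) (Gi.map (algebraMap ℚ _)) p q
    genA genB
  rw [mapMatrix_map_algebraMap, mapMatrix_map_algebraMap, mapMatrix_map_algebraMap, mapMatrix_map_algebraMap,
    mapMatrix_map_algebraMap, mapMatrix_map_algebraMap, mapMatrix_aeval_genA, mapMatrix_aeval_genB,
    RingHom.coe_coe] at this
  exact this

/-- The denominator polynomial is not zero (it is `1` at the origin). [folklore] -/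
theorem denPoly₂_ne_zero (S Si T Ti G Gi : Matrix (Fin N) (Fin N) ℚ) (p q : ℕ) : denPoly₂ S Si T Ti G Gi p q ≠ 0 := by
  intro h
  have h1 := aeval_denPoly₂ (K := ℚ) S Si T Ti G Gi p q 0 0
  rw [h, map_zero, uDen₂_zero] at h1
  exact zero_ne_one h1

end Generic


end Summit.HodgeConjecture.HodgeConjecture.Theorems.Q8SymplecticPowersCayleyParameters

end
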